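import Mathlib
import HarnessLib
import Summits.Ventures.LatticeQCDFlow.Exactness.SUNStoutLayerJacobian
import Summits.Ventures.LatticeQCDFlow.Exactness.Phi4FlowSamplerErgodic
import Summits.Ventures.LatticeQCDFlow.Exactness.MetropolisSweepInstances

/-!
# The `SU(N)` stout-flow sampler for the Wilson action is exact AND uniformly ergodic, for every `N`

HONEST FRAMING: exact (Metropolis-corrected) sampling algorithms for lattice gauge theory;
figures of merit are autocorrelation/cost numbers at stated couplings and volumes; no
continuum-physics claim.

Venture `LatticeQCDFlow` (cell pub-lqcd), topic `Exactness`; FANOUT row 10 (`eng-equiv`: the engine's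
flow sampler = gauge-equivariant flow proposals + independence Metropolis, `equiv/imh.py`,
`flows_jax/*_flow.make_proposer`).  NEW WORK of the cell composing this row's `HasJacobian` certificate
for the `SU(N)` stout layer (`SUNStoutLayerJacobian.exists_stoutLayer_fthmc_data`)
with row 30's general flow-MCMC kernel (`IMHKernel.indepMH`), its exactness (`FlowSamplerExact`) and
row 2's Doeblin bound (`Phi4FlowSamplerErgodic.flowMCMC_uniformly_ergodic`), and the tree's Wilson
measure (`MetropolisSweepInstances.gibbsProbability_eq_wilsonMeasure`, `wilsonBoltzmann_pinched`).
No definition is introduced.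

* **`stout_flowSampler_exact_uniformlyErgodic`** — for every `n`, `d`, `L ≥ 1`, every continuous
  unitary representation `ρ` and coupling `β`, every mask meeting h1–h6 and every `r` with
  `2(d−1)|r| < 1`: let `Ψ` be the masked stout step and `J` its continuous positive Jacobian.  The
  sampler "propose `U' ∼ Ψ_* Haar^⊗` (push the Haar prior through the flow), accept with
  `min(1, w(U')/w(U))`, `w = e^{−βS_W} · (J ∘ Ψ⁻¹)` (the un-normalised weight the code evaluates:
  target over model density)" leaves `wilsonMeasure ρ β` INVARIANT and converges to it from EVERY
  initial law at a geometric rate `(1 − δ)ᵗ`, `δ ∈ (0, 1]` — the compactness of `SU(n)^E` and the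
  continuity of `J` bound the importance weight, which is Mengersen–Tweedie's criterion (named only).

NOT CLAIMED: any value of `δ`; trained (non-constant-coefficient) flows beyond what
`exists_stoutLayer_fthmc_data_of_frozenCoeff` covers; multi-layer flows (compose `HasJacobian.comp`).
-/

noncomputable section

namespace Summit.Ventures.LatticeQCDFlow.Exactness

open Literature.MathematicalPhysics.QuantumFieldTheory
open Literature.MathematicalPhysics.QuantumFieldTheory.Luscher2010
open MeasureTheory ProbabilityTheory ProbabilityTheory.Kernel Filter Set
open scoped Matrix Topology ENNReal

variable {d L n : ℕ} [NeZero L]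

/-- **THE `SU(N)` STOUT-FLOW SAMPLER FOR THE WILSON ACTION IS EXACT AND UNIFORMLY ERGODIC.** -/
theorem stout_flowSampler_exact_uniformlyErgodic {N : ℕ}
    (ρ : Matrix.specialUnitaryGroup (Fin n) ℂ →* Matrix (Fin N) (Fin N) ℂ) (hρ : Continuous ρ) (β : ℝ)
    (p : Edge d L → Prop) [DecidablePred p] (r : ℝ)
    (h1 : ∀ e, p e → ∀ ν, ν ≠ e.2 → ¬p (e.1.shift e.2, ν))
    (h2 : ∀ e, p e → ∀ ν, ν ≠ e.2 → ¬p (e.1.shift ν, e.2))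
    (h3 : ∀ e, p e → ∀ ν, ν ≠ e.2 → ¬p (e.1, ν))
    (h4 : ∀ e, p e → ∀ ν, ν ≠ e.2 → ¬p ((e.1 - Pi.single ν 1).shift e.2, ν))
    (h5 : ∀ e, p e → ∀ ν, ν ≠ e.2 → ¬p (e.1 - Pi.single ν 1, e.2))
    (h6 : ∀ e, p e → ∀ ν, ν ≠ e.2 → ¬p (e.1 - Pi.single ν 1, ν))
    (hr : 2 * (d - 1 : ℝ) * |r| < 1) :
    ∃ (Ψ : GaugeConfig d L (Matrix.specialUnitaryGroup (Fin n) ℂ) ≃ᵐ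
        GaugeConfig d L (Matrix.specialUnitaryGroup (Fin n) ℂ))
      (J : GaugeConfig d L (Matrix.specialUnitaryGroup (Fin n) ℂ) → ℝ),
      (⇑Ψ = fun (V : GaugeConfig d L (Matrix.specialUnitaryGroup (Fin n) ℂ)) (e : Edge d L) =>
        if p e then
          (⟨NormedSpace.exp ((r : ℂ) • suProj (plaquetteLoopSum V e.1 e.2)),
              exp_smul_suProj_mem r (plaquetteLoopSum V e.1 e.2)⟩ :
            Matrix.specialUnitaryGroup (Fin n) ℂ) * V e
        else V e) ∧
      HasJacobian (Measure.pi fun _ : Edge d L => haarProbability (Matrix.specialUnitaryGroup (Fin n) ℂ))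
        Ψ (fun v => ENNReal.ofReal (J v)) ∧ (∀ U, 0 < J U) ∧
      (haveI : IsProbabilityMeasure
          ((Measure.pi fun _ : Edge d L => haarProbability (Matrix.specialUnitaryGroup (Fin n) ℂ)).map Ψ) :=
        Measure.isProbabilityMeasure_map Ψ.measurable.aemeasurable
      Kernel.Invariant
          (indepMH ((Measure.pi fun _ : Edge d L =>
              haarProbability (Matrix.specialUnitaryGroup (Fin n) ℂ)).map Ψ)
            (fun U => Real.exp (-β * wilsonAction ρ U) * J (Ψ.symm U)))
          (wilsonMeasure (d := d) (L := L) ρ β) ∧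
        ∃ δ : ℝ, 0 < δ ∧ δ ≤ 1 ∧
          ∀ (μ₀ : Measure (GaugeConfig d L (Matrix.specialUnitaryGroup (Fin n) ℂ))) [IsProbabilityMeasure μ₀]
            (t : ℕ) (A : Set (GaugeConfig d L (Matrix.specialUnitaryGroup (Fin n) ℂ))),
            |((fun m : Measure (GaugeConfig d L (Matrix.specialUnitaryGroup (Fin n) ℂ)) =>
                  m.bind (indepMH ((Measure.pi fun _ : Edge d L =>
                      haarProbability (Matrix.specialUnitaryGroup (Fin n) ℂ)).map Ψ)
                    (fun U => Real.exp (-β * wilsonAction ρ U) * J (Ψ.symm U))))^[t] μ₀).real A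
                - (wilsonMeasure (d := d) (L := L) ρ β).real A| ≤ (1 - δ) ^ t) := by
  -- the layer, its Jacobian, and the pinching constants
  obtain ⟨Ψ, J, j₁, j₂, hΨ, hJm, hj₁, hJ₁, hJ₂, hF⟩ :=
    exists_stoutLayer_fthmc_data (n := n) p r h1 h2 h3 h4 h5 h6 hr
  have hJ0 : ∀ U, 0 < J U := fun U => hj₁.trans_le (hJ₁ U)
  set vol : Measure (GaugeConfig d L (Matrix.specialUnitaryGroup (Fin n) ℂ)) :=
    Measure.pi fun _ : Edge d L => haarProbability (Matrix.specialUnitaryGroup (Fin n) ℂ) with hvol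
  haveI hvolP : IsProbabilityMeasure vol := by rw [hvol]; infer_instance
  -- the model density `q = 1/(J ∘ Ψ⁻¹)` of `Ψ_* Haar^⊗`
  set q : GaugeConfig d L (Matrix.specialUnitaryGroup (Fin n) ℂ) → ℝ := fun U => (J (Ψ.symm U))⁻¹ with hq
  have hq0 : ∀ U, 0 < q U := fun U => inv_pos.2 (hJ0 _)
  have hqm : Measurable q := (hJm.comp Ψ.symm.measurable).inv
  have hmodel : vol.map Ψ = vol.withDensity fun U => ENNReal.ofReal (q U) := by
    have h := hF.map_withDensity_equiv (fun z => (ENNReal.ofReal_pos.2 (hJ0 z)).ne')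
      (fun z => ENNReal.ofReal_ne_top) (r := fun _ => (1 : ℝ≥0∞)) measurable_const
    have hone : vol.withDensity (fun _ => (1 : ℝ≥0∞)) = vol := MeasureTheory.withDensity_one
    rw [hone] at h
    rw [h]
    refine withDensity_congr_ae (Filter.Eventually.of_forall fun U => ?_)
    show 1 / ENNReal.ofReal (J (Ψ.symm U)) = ENNReal.ofReal ((J (Ψ.symm U))⁻¹)
    rw [one_div, ENNReal.ofReal_inv_of_pos (hJ0 _)]
  haveI hQ : IsProbabilityMeasure (vol.withDensity fun U => ENNReal.ofReal (q U)) := by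
    rw [← hmodel]
    exact Measure.isProbabilityMeasure_map Ψ.measurable.aemeasurable
  -- the normalised target density `Z⁻¹ e^{−βS_W}`
  obtain ⟨s₀, hlo, hhi, hfm⟩ := wilsonBoltzmann_pinched (d := d) (L := L) ρ hρ β
  have hZ := gibbs_partition_ne (μ := vol) (Real.exp_pos (-s₀)) hlo hhi
  set Z : ℝ≥0∞ := (vol.withDensity fun U => ENNReal.ofReal (Real.exp (-β * wilsonAction ρ U))) univ with hZdef
  have hZpos : 0 < Z.toReal := ENNReal.toReal_pos hZ.1 hZ.2
  set pd : GaugeConfig d L (Matrix.specialUnitaryGroup (Fin n) ℂ) → ℝ :=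
    fun U => Z.toReal⁻¹ * Real.exp (-β * wilsonAction ρ U) with hpd
  have hpm : Measurable pd := hfm.const_mul _
  have hp0 : ∀ U, 0 < pd U := fun U => mul_pos (inv_pos.2 hZpos) (Real.exp_pos _)
  have htarget : (vol.withDensity fun U => ENNReal.ofReal (pd U)) = wilsonMeasure (d := d) (L := L) ρ β := by
    rw [← gibbsProbability_eq_wilsonMeasure, gibbsProbability]
    have h1 : (fun U => ENNReal.ofReal (pd U)) =
        Z⁻¹ • fun U => ENNReal.ofReal (Real.exp (-β * wilsonAction ρ U)) := by
      funext U
      rw [Pi.smul_apply, smul_eq_mul, hpd]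
      dsimp only
      rw [ENNReal.ofReal_mul (inv_nonneg.2 hZpos.le), ENNReal.ofReal_inv_of_pos hZpos,
        ENNReal.ofReal_toReal hZ.2]
    rw [h1, withDensity_smul _ hfm.ennreal_ofReal]
  haveI hP : IsProbabilityMeasure (vol.withDensity fun U => ENNReal.ofReal (pd U)) := by
    rw [htarget, ← gibbsProbability_eq_wilsonMeasure]
    exact isProbabilityMeasure_gibbsProbability (μ := vol) (Real.exp_pos (-s₀)) hlo hhi
  -- the weight bound `pd ≤ M q`
  have hM : ∀ U, pd U ≤ (Z.toReal⁻¹ * Real.exp s₀ * j₂) * q U := by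
    intro U
    have hJU : J (Ψ.symm U) ≤ j₂ := hJ₂ _
    have hJpos : 0 < J (Ψ.symm U) := hJ0 _
    have hj₂pos : 0 < j₂ := hJpos.trans_le hJU
    rw [hq]
    dsimp only
    rw [hpd]
    dsimp only
    have h1 : Real.exp (-β * wilsonAction ρ U) ≤ Real.exp s₀ := hhi U
    have h2 : (1 : ℝ) ≤ j₂ * (J (Ψ.symm U))⁻¹ := by
      rw [← div_eq_mul_inv, le_div_iff₀ hJpos, one_mul]
      exact hJU
    calc Z.toReal⁻¹ * Real.exp (-β * wilsonAction ρ U)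
        ≤ Z.toReal⁻¹ * Real.exp s₀ * 1 := by
          rw [mul_one]; exact mul_le_mul_of_nonneg_left h1 (inv_nonneg.2 hZpos.le)
      _ ≤ Z.toReal⁻¹ * Real.exp s₀ * (j₂ * (J (Ψ.symm U))⁻¹) :=
          mul_le_mul_of_nonneg_left h2 (mul_nonneg (inv_nonneg.2 hZpos.le) (Real.exp_pos _).le)
      _ = Z.toReal⁻¹ * Real.exp s₀ * j₂ * (J (Ψ.symm U))⁻¹ := by ring
  -- the code's weight is a positive multiple of `pd/q`
  have hw : (fun U => pd U / q U) = fun U => Z.toReal⁻¹ * (Real.exp (-β * wilsonAction ρ U) * J (Ψ.symm U)) := by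
    funext U
    rw [hpd, hq]
    dsimp only
    rw [div_inv_eq_mul, mul_assoc]
  -- transport along `vol.map Ψ = q · vol`
  have key : ∀ (ν : Measure (GaugeConfig d L (Matrix.specialUnitaryGroup (Fin n) ℂ))) [IsProbabilityMeasure ν],
      ν = vol.withDensity (fun U => ENNReal.ofReal (q U)) →
      Kernel.Invariant (indepMH ν (fun U => Real.exp (-β * wilsonAction ρ U) * J (Ψ.symm U)))
          (wilsonMeasure (d := d) (L := L) ρ β) ∧
        ∃ δ : ℝ, 0 < δ ∧ δ ≤ 1 ∧
          ∀ (μ₀ : Measure (GaugeConfig d L (Matrix.specialUnitaryGroup (Fin n) ℂ))) [IsProbabilityMeasure μ₀]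
            (t : ℕ) (A : Set (GaugeConfig d L (Matrix.specialUnitaryGroup (Fin n) ℂ))),
            |((fun m : Measure (GaugeConfig d L (Matrix.specialUnitaryGroup (Fin n) ℂ)) =>
                  m.bind (indepMH ν (fun U => Real.exp (-β * wilsonAction ρ U) * J (Ψ.symm U))))^[t] μ₀).real A
                - (wilsonMeasure (d := d) (L := L) ρ β).real A| ≤ (1 - δ) ^ t := by
    intro ν hν hνq
    subst hνq
    have hker : indepMH (vol.withDensity fun U => ENNReal.ofReal (q U))
        (fun U => Real.exp (-β * wilsonAction ρ U) * J (Ψ.symm U)) =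
        indepMH (vol.withDensity fun U => ENNReal.ofReal (q U)) (fun U => pd U / q U) := by
      rw [hw, indepMH_const_mul _ (inv_pos.2 hZpos)]
    have hMpos : 0 < Z.toReal⁻¹ * Real.exp s₀ * j₂ := by
      have : 0 < j₂ := hj₁.trans_le ((hJ₁ (Ψ.symm (Classical.arbitrary _))).trans (hJ₂ _))
      positivity
    have h1M : 1 ≤ Z.toReal⁻¹ * Real.exp s₀ * j₂ := one_le_of_density_le (vol := vol) (p := pd) hqm hq0 hM
    refine ⟨?_, (Z.toReal⁻¹ * Real.exp s₀ * j₂)⁻¹, inv_pos.2 hMpos, inv_le_one_of_one_le₀ h1M,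
      fun μ₀ _ t A => ?_⟩
    · rw [hker, ← htarget]
      exact flowMCMC_invariant hpm hqm hp0 hq0
    · rw [hker, ← htarget]
      exact flowMCMC_uniformly_ergodic hpm hqm hp0 hq0 hM μ₀ t A
  refine ⟨Ψ, J, hΨ, hF, hJ0, ?_⟩
  haveI : IsProbabilityMeasure (vol.map Ψ) := Measure.isProbabilityMeasure_map Ψ.measurable.aemeasurable
  exact key (vol.map Ψ) hmodel

end Summit.Ventures.LatticeQCDFlow.Exactness

end
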